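import Summits.ValiantsHypothesis.ValiantsHypothesis.Theorems.FifoMatchingNNDivisionHardLocalizationUPat
import Literature.Barriers.PneNP.TSPExtensionComplexityHyperplaneBound

/-!
# FifoMatching · NNDivisionHard · Localization — `PatternSplit`: THE BUDGET SPLIT OF A SUPPORT CERTIFICATE

Theorems port (val-idea-41 g6 staging; declarations verbatim, namespace moved) of the crux workfile
`Cruxes/NNDivisionHard/PatternSplit41.lean` rev 1 @db0e975a6158 (sha16 a8d5d1a0460253ce; critic V#141a KEPT — STRUCTURAL, port CONTENT GO).
PART A = §1–§3 (this file); PART B = §3b–§4 (`…LocalizationPatternSplitDefects`).  The section guide below covers both parts.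

Source: crux workfile for `stmt-ValiantsHypothesis-21181` (`FifoMatching.NNDivisionHard`), REFUTE lens «a `Q` with small `xc(COR + Q)`».
Kernel food about GENUS I (`UPatAt`, Theorems part 12 `…LocalizationUPat`, §B7 of `Symmetry43`): the CONVERSE of its universality.

§B7 made the unique-disjointness pattern universal by letting the row depend on `a` AND the passenger column point depend on `b`
(«no common maximiser, no single top, no located face»).  This file shows what that freedom buys AGAINST A BUDGETED PASSENGER:

* §1 `card_filter_pos_le_of_factor` — the counting heart: a nonnegative matrix on `Finset (Fin m) × Finset (Fin m)` that factors through
  `κ` nonnegative coordinates and VANISHES on the cells `#(a ∩ b) = 1` is positive on at most `|κ| · 2^m` DISJOINT cells (its positive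
  cells lie in `|κ|` rectangles, each Kaibel–Weltge-valid).  Corollary `three_pow_le_add_card_defects`: the DEFECT-TOLERANT
  Yannakakis–Kaibel–Weltge bound `3^m ≤ (r+1)·2^m + #{disjoint cells with slack 0}` for ANY set with a size-`r` EF (generalises Literature
  `HasEFOfSize.three_pow_le`, which is the case of zero defects).
* §2 `swap_max_right/left` + `exists_split` — every pattern on `P + Q` SPLITS: `x b = y b + z b` (`y b ∈ P`, `z b ∈ Q`), the rhs as
  `d a = dP a + dQ a` with `(c a, dP a)` valid on `P`, `(c a, dQ a)` valid on `Q`; on a tight cell BOTH parts are tight — in particular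
  `z b` is a COMMON MAXIMISER over `Q` of every row of the star `{a : #(a ∩ b) = 1}` (COLUMN COMPLIANCE, by the swap argument: replacing the
  `Q`-part of a tight point keeps it in `P + Q`); on a disjoint cell at least one part is strict; and if `Q` has a size-`r` EF, the cells where
  the `P`-part is NOT strict number at most `(r+1)·2^m` (§1 applied to the `Q`-slack).
* §3 tree currency (`Fam`, `UPatAt`, `COR(K_h)`): `Compliant`, `CorPat D` (an almost-unique-disjointness system of COR-valid rows and COR
  points with at most `D` non-strict disjoint cells), ★ `uPatAt_split : UPatAt q m → HasEFOfSize (conv q) r → ∃ …, CorPat ((r+1)·2^m) … ∧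
  Compliant q …`, the converse recipe `uPatAt_of_corPat : CorPat 0 … → Compliant q … → UPatAt q m`, and `corPat_three_pow_le`.
  SLOGAN: «`UPat ∘ budget ⊆ column-PCM ∘ almost-UDISJ(COR)`» — against a budgeted passenger the universality of §B7 buys at most
  `(r+1)·2^m` disjoint cells over the passenger-common-maximiser species; the enemy clause (E-U) becomes COR-INTRINSIC: a residual member is
  a budgeted `Q` whose maximiser structure is column-INcompatible with every `(r+1)·2^m`-defective unique-disjointness system of COR.
* §3b GENUS I WITH DEFECTS: `UPatAtD q m D` (at most `D` disjoint cells non-strict; sub-boards cannot remove defects, so the notion is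
  wider), ★ `uPatAtD_three_pow_le : 3^m ≤ (r+1)·2^m + D` (budget-free), the class `UPatDF s` (order `> s h`, at most a third of the
  `3^m` disjoint cells defective) and ★ `decided_uPatDF` / `uPatD_decided : Decided (UPatDF ⌊√·⌋)` — the defective genus is DECIDED with
  the floors and exchanges of `decided_uPatF`; `uPatF_succ_le_uPatDF` (genus I one order up sits inside).
* §4 `no_pattern_of_uniqueNormal` — the LIMIT REMARK made a theorem: if every maximiser of a nonzero functional over `Q` determines the
  functional up to a positive scalar (a SMOOTH convex passenger: balls, ellipsoids), then `P + Q` carries NO pattern of order `≥ 2`, for ANY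
  `P`; §4b the kernel instance `uniqueNormal_euclidBall` (Cauchy–Schwarz through `(c·c) z − (c·z) c`) and `no_pattern_euclidBall`.
  (A ball is not a polytope, so this is outside the law; it explains why pattern-immunity is an exact-incidence, non-robust property:
  polytopal approximations of a ball are decided by `Face` / (E-7), the limit body is totally immune — (E-U) has members in the closure.)

Honest label: a STRUCTURE THEOREM for genus I under budget + its defective widening (decided) + one limit remark with a kernel
instance; no new law, no residual (polytopal, budgeted) member, not progress on `CoreLawHull` / `ExactPencilLaw`; 21181 OPEN;
VP ≠ VNP NOT proved.  `rc 0`, no proof placeholders, axioms `propext`, `Classical.choice`, `Quot.sound`.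
-/

set_option linter.dupNamespace false

namespace Summit.ValiantsHypothesis.ValiantsHypothesis.Theorems.FifoMatching.PatternSplit

open Matrix Finset
open scoped Pointwise
open Literature.Barriers.PneNP (HasEFOfSize disjPairs mem_disjPairs card_disjPairs IsKWValid)
open Literature.Combinatorics.Optimization (corPolytopeGraph corVec)
open Summit.ValiantsHypothesis.ValiantsHypothesis.Theorems.FifoMatching.Localization (Fam UPatAt)

/-! ## §1 Counting: positive cells of a vanishing-on-`#(a∩b)=1` nonnegative factorisation, and the defect-tolerant bound -/

section Counting

variable {m : ℕ}

/-- `(disjPairs univ).card = 3 ^ m` on `Fin m`. -/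
theorem card_disjPairs_univ : (disjPairs (univ : Finset (Fin m))).card = 3 ^ m := by
  rw [card_disjPairs, card_univ, Fintype.card_fin]

open Classical in
/-- ★ **the counting heart.**  A matrix `B a b = ∑ k, U a k * V b k` with `U, V ≥ 0` that vanishes on every cell with `#(a ∩ b) = 1` is
positive on at most `|κ| · 2^m` disjoint cells: the positive cells lie in the `|κ|` rectangles `{U · k > 0} × {V · k > 0}`, each of which is
Kaibel–Weltge-valid (a cell of such a rectangle has `B > 0`, hence `#(a ∩ b) ≠ 1`), hence holds at most `2^m` disjoint pairs. -/
theorem card_filter_pos_le_of_factor {κ : Type*} [Fintype κ] (U V : Finset (Fin m) → κ → ℝ)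
    (hU : ∀ a k, 0 ≤ U a k) (hV : ∀ b k, 0 ≤ V b k)
    (hone : ∀ a b : Finset (Fin m), (a ∩ b).card = 1 → ∑ k, U a k * V b k = 0) :
    ((disjPairs (univ : Finset (Fin m))).filter fun p => 0 < ∑ k, U p.1 k * V p.2 k).card ≤ Fintype.card κ * 2 ^ m := by
  set R : κ → Finset (Finset (Fin m) × Finset (Fin m)) :=
    fun k => (disjPairs (univ : Finset (Fin m))).filter fun p => 0 < U p.1 k ∧ 0 < V p.2 k with hR
  have hvalid : ∀ k, IsKWValid (R k) := by
    intro k p hp p' hp' h1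
    have hp1 := (mem_filter.1 hp).2.1
    have hp2 := (mem_filter.1 hp').2.2
    have hsum := hone p.1 p'.2 h1
    have hle : U p.1 k * V p'.2 k ≤ ∑ k', U p.1 k' * V p'.2 k' :=
      single_le_sum (f := fun k' => U p.1 k' * V p'.2 k') (fun k' _ => mul_nonneg (hU _ _) (hV _ _)) (mem_univ k)
    have hpos : 0 < U p.1 k * V p'.2 k := mul_pos hp1 hp2
    linarith
  have hsub : ((disjPairs (univ : Finset (Fin m))).filter fun p => 0 < ∑ k, U p.1 k * V p.2 k) ⊆
      (univ : Finset κ).biUnion R := by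
    intro p hp
    rw [mem_filter] at hp
    obtain ⟨k, -, hk⟩ := exists_lt_of_sum_lt (by simpa using hp.2 : ∑ _k : κ, (0 : ℝ) < ∑ k, U p.1 k * V p.2 k)
    have hUk : 0 < U p.1 k := by
      rcases (hU p.1 k).lt_or_eq with h | h
      · exact h
      · rw [← h, zero_mul] at hk; exact absurd hk (lt_irrefl 0)
    have hVk : 0 < V p.2 k := by
      rcases (hV p.2 k).lt_or_eq with h | h
      · exact h
      · rw [← h, mul_zero] at hk; exact absurd hk (lt_irrefl 0)
    exact mem_biUnion.2 ⟨k, mem_univ k, mem_filter.2 ⟨hp.1, hUk, hVk⟩⟩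
  calc ((disjPairs (univ : Finset (Fin m))).filter fun p => 0 < ∑ k, U p.1 k * V p.2 k).card
      ≤ ((univ : Finset κ).biUnion R).card := card_le_card hsub
    _ ≤ ∑ k, (R k).card := card_biUnion_le
    _ ≤ ∑ _k : κ, 2 ^ m := sum_le_sum fun k _ => by
        have h := IsKWValid.card_le_two_pow (univ : Finset (Fin m)) (R k) (hvalid k) (filter_subset _ _)
        rwa [card_univ, Fintype.card_fin] at h
    _ = Fintype.card κ * 2 ^ m := by rw [sum_const, card_univ, smul_eq_mul]

open Classical in
/-- ★ **DEFECT-TOLERANT Yannakakis–Kaibel–Weltge.**  For ANY set `P` with a size-`r` extended formulation, rows `c a · x ≤ d a` valid on `P`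
and points `v b ∈ P` (`a, b ⊆ Fin m`) whose slack VANISHES on every cell with `#(a ∩ b) = 1`:
`3^m ≤ (r+1)·2^m + #{(a,b) disjoint : slack (a,b) = 0}`.  (Literature `HasEFOfSize.three_pow_le` is the case of no such cell.) -/
theorem three_pow_le_add_card_defects {ι : Type} [Fintype ι] {P : Set (ι → ℝ)} {r : ℕ} (hP : HasEFOfSize P r)
    (v : Finset (Fin m) → ι → ℝ) (hv : ∀ b, v b ∈ P) (c : Finset (Fin m) → ι → ℝ) (d : Finset (Fin m) → ℝ)
    (hvalid : ∀ a, ∀ x ∈ P, c a ⬝ᵥ x ≤ d a) (hone : ∀ a b, (a ∩ b).card = 1 → c a ⬝ᵥ v b = d a) :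
    3 ^ m ≤ (r + 1) * 2 ^ m + ((disjPairs (univ : Finset (Fin m))).filter fun p => c p.1 ⬝ᵥ v p.2 = d p.1).card := by
  obtain ⟨U, T, hU, hT, hfac⟩ := hP.exists_nonneg_factorization v hv c d hvalid
  have hzero : ∀ a b : Finset (Fin m), (a ∩ b).card = 1 → ∑ k, U a k * T b k = 0 := by
    intro a b h1; rw [← hfac]; linarith [hone a b h1]
  have hcount := card_filter_pos_le_of_factor U T hU hT hzero
  rw [Fintype.card_option, Fintype.card_fin] at hcount
  have hsplit : (disjPairs (univ : Finset (Fin m))).card ≤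
      ((disjPairs (univ : Finset (Fin m))).filter fun p => 0 < ∑ k, U p.1 k * T p.2 k).card +
      ((disjPairs (univ : Finset (Fin m))).filter fun p => c p.1 ⬝ᵥ v p.2 = d p.1).card := by
    rw [← card_union_of_disjoint]
    · refine card_le_card fun p hp => ?_
      rw [mem_union, mem_filter, mem_filter]
      by_cases h : c p.1 ⬝ᵥ v p.2 = d p.1
      · exact Or.inr ⟨hp, h⟩
      · refine Or.inl ⟨hp, ?_⟩
        rw [← hfac]
        have := hvalid p.1 (v p.2) (hv p.2)
        exact sub_pos.2 (lt_of_le_of_ne this h)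
    · rw [disjoint_filter]
      intro p _ hpos heq
      rw [← hfac, heq, sub_self] at hpos
      exact lt_irrefl _ hpos
  rw [card_disjPairs_univ] at hsplit
  omega

end Counting

/-! ## §2 The split of a pattern on a Minkowski sum (column compliance by the swap argument) -/

section Split

variable {ι : Type} [Fintype ι]

/-- **swap argument, passenger side**: if `y + z` (`y ∈ P`, `z ∈ Q`) is a TIGHT point of an inequality valid on `P + Q`, then `z` maximises
the row over `Q` (replace the `Q`-part: `y + z'` stays in `P + Q`). -/
theorem swap_max_right {P Q : Set (ι → ℝ)} {c y z : ι → ℝ} {d : ℝ} (hvalid : ∀ x ∈ P + Q, c ⬝ᵥ x ≤ d)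
    (hy : y ∈ P) (htight : c ⬝ᵥ (y + z) = d) : ∀ z' ∈ Q, c ⬝ᵥ z' ≤ c ⬝ᵥ z := by
  intro z' hz'
  have h := hvalid (y + z') (Set.add_mem_add hy hz')
  rw [dotProduct_add] at h htight
  linarith

/-- **swap argument, COR side**: symmetrically `y` maximises the row over `P`. -/
theorem swap_max_left {P Q : Set (ι → ℝ)} {c y z : ι → ℝ} {d : ℝ} (hvalid : ∀ x ∈ P + Q, c ⬝ᵥ x ≤ d)
    (hz : z ∈ Q) (htight : c ⬝ᵥ (y + z) = d) : ∀ y' ∈ P, c ⬝ᵥ y' ≤ c ⬝ᵥ y := by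
  intro y' hy'
  have h := hvalid (y' + z) (Set.add_mem_add hy' hz)
  rw [dotProduct_add] at h htight
  linarith

/-- the passenger value of a row: `dQ = sup_{z ∈ Q} c · z` (a real `sSup`; `Q` nonempty and the row bounded on `Q` in all uses). -/
noncomputable def supOn (Q : Set (ι → ℝ)) (c : ι → ℝ) : ℝ := sSup ((fun z => c ⬝ᵥ z) '' Q)

/-- any point of `Q` bounds `supOn Q c` from below (given an upper bound so the `sSup` is a real supremum). -/
theorem le_supOn {Q : Set (ι → ℝ)} {c : ι → ℝ} {M : ℝ} (hbdd : ∀ z ∈ Q, c ⬝ᵥ z ≤ M) {z : ι → ℝ} (hz : z ∈ Q) :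
    c ⬝ᵥ z ≤ supOn Q c :=
  le_csSup ⟨M, by rintro _ ⟨z', hz', rfl⟩; exact hbdd z' hz'⟩ ⟨z, hz, rfl⟩

/-- an upper bound of the row on a nonempty `Q` bounds `supOn Q c` from above. -/
theorem supOn_le {Q : Set (ι → ℝ)} (hQ : Q.Nonempty) {c : ι → ℝ} {M : ℝ} (hbdd : ∀ z ∈ Q, c ⬝ᵥ z ≤ M) : supOn Q c ≤ M :=
  csSup_le (hQ.image _) (by rintro _ ⟨z', hz', rfl⟩; exact hbdd z' hz')

/-- at a maximiser the row value IS `supOn Q c`. -/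
theorem supOn_eq_of_max {Q : Set (ι → ℝ)} {c z : ι → ℝ} (hz : z ∈ Q) (hmax : ∀ z' ∈ Q, c ⬝ᵥ z' ≤ c ⬝ᵥ z) :
    supOn Q c = c ⬝ᵥ z :=
  le_antisymm (supOn_le ⟨z, hz⟩ hmax) (le_supOn hmax hz)

open Classical in
/-- ★★ **THE SPLIT.**  Rows `c a · x ≤ d a` valid on `P + Q` and points `x b ∈ P + Q` (`a, b ⊆ Fin m`) with slack `0` on `#(a ∩ b) = 1` and
slack `> 0` on disjoint pairs SPLIT: `x b = y b + z b`, `y b ∈ P`, `z b ∈ Q`, rhs `dP a + dQ a = d a` on every row with a tight cell (all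
`a ≠ ∅`; in general `dP a := d a − dQ a ≥ sup_P`), `(c a, dP a)` valid on `P`, `(c a, dQ a)` valid on `Q`, BOTH PARTS TIGHT on tight cells
(so `z b` is a common maximiser over `Q` of the whole star of `b`, and `y b` one over `P`), at least one part strict on disjoint cells — and,
if `Q` has a size-`r` extended formulation, the disjoint cells whose `P`-part is NOT strict number at most `(r+1)·2^m`. -/
theorem exists_split {m : ℕ} {P Q : Set (ι → ℝ)} {r : ℕ} (hQ : HasEFOfSize Q r)
    (c : Finset (Fin m) → ι → ℝ) (d : Finset (Fin m) → ℝ) (x : Finset (Fin m) → ι → ℝ)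
    (hvalid : ∀ a, ∀ w ∈ P + Q, c a ⬝ᵥ w ≤ d a) (hx : ∀ b, x b ∈ P + Q)
    (htight : ∀ a b, (a ∩ b).card = 1 → c a ⬝ᵥ x b = d a) (hdisj : ∀ a b, Disjoint a b → c a ⬝ᵥ x b < d a) :
    ∃ (dP dQ : Finset (Fin m) → ℝ) (y z : Finset (Fin m) → ι → ℝ),
      (∀ b, y b ∈ P) ∧ (∀ b, z b ∈ Q) ∧ (∀ b, x b = y b + z b) ∧ (∀ a, dP a + dQ a = d a) ∧
      (∀ a, ∀ w ∈ P, c a ⬝ᵥ w ≤ dP a) ∧ (∀ a, ∀ w ∈ Q, c a ⬝ᵥ w ≤ dQ a) ∧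
      (∀ a b, (a ∩ b).card = 1 → c a ⬝ᵥ y b = dP a ∧ c a ⬝ᵥ z b = dQ a) ∧
      (∀ a b, (a ∩ b).card = 1 → ∀ w ∈ Q, c a ⬝ᵥ w ≤ c a ⬝ᵥ z b) ∧
      (∀ a b, Disjoint a b → c a ⬝ᵥ y b < dP a ∨ c a ⬝ᵥ z b < dQ a) ∧
      (∀ a b, Disjoint a b → c a ⬝ᵥ y b = dP a → c a ⬝ᵥ z b < dQ a) ∧
      ((disjPairs (univ : Finset (Fin m))).filter fun p => c p.1 ⬝ᵥ y p.2 = dP p.1).card ≤ (r + 1) * 2 ^ m := by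
  -- decompose the points
  have hdec : ∀ b, ∃ y z, y ∈ P ∧ z ∈ Q ∧ x b = y + z := by
    intro b
    obtain ⟨y, hy, z, hz, hyz⟩ := Set.mem_add.1 (hx b)
    exact ⟨y, z, hy, hz, hyz.symm⟩
  choose y z hy hz hxyz using hdec
  have hPne : P.Nonempty := ⟨y ∅, hy ∅⟩
  have hQne : Q.Nonempty := ⟨z ∅, hz ∅⟩
  -- the passenger rhs `dQ a := sup_Q c a`, bounded by `d a − c a · y₀`
  have hbddQ : ∀ a, ∀ w ∈ Q, c a ⬝ᵥ w ≤ d a - c a ⬝ᵥ y ∅ := by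
    intro a w hw
    have h := hvalid a (y ∅ + w) (Set.add_mem_add (hy ∅) hw)
    rw [dotProduct_add] at h
    linarith
  refine ⟨fun a => d a - supOn Q (c a), fun a => supOn Q (c a), y, z, hy, hz, hxyz, fun a => by ring, ?_, ?_, ?_, ?_, ?_, ?_, ?_⟩
  · -- validity on `P`: `sup_Q c a ≤ d a − c a · w` for `w ∈ P`
    intro a w hw
    have : supOn Q (c a) ≤ d a - c a ⬝ᵥ w := supOn_le hQne fun w' hw' => by
      have h := hvalid a (w + w') (Set.add_mem_add hw hw')
      rw [dotProduct_add] at h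
      linarith
    linarith
  · exact fun a w hw => le_supOn (hbddQ a) hw
  · intro a b h1
    have ht := htight a b h1
    rw [hxyz b, dotProduct_add] at ht
    have h1' : c a ⬝ᵥ z b ≤ supOn Q (c a) := le_supOn (hbddQ a) (hz b)
    have h2' : supOn Q (c a) ≤ d a - c a ⬝ᵥ y b := supOn_le hQne fun w' hw' => by
      have h := hvalid a (y b + w') (Set.add_mem_add (hy b) hw')
      rw [dotProduct_add] at h
      linarith
    constructor <;> linarith
  · intro a b h1
    have ht := htight a b h1
    rw [hxyz b] at ht
    exact swap_max_right (hvalid a) (hy b) ht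
  · intro a b hab
    have hs := hdisj a b hab
    rw [hxyz b, dotProduct_add] at hs
    by_contra hcon
    simp only [not_or, not_lt] at hcon
    linarith [hcon.1, hcon.2]
  · intro a b hab heq
    have hs := hdisj a b hab
    rw [hxyz b, dotProduct_add] at hs
    linarith
  · -- the defect count: cells with tight `P`-part are `Q`-positive, and the `Q`-slack factors through `r + 1` nonnegative coordinates
    obtain ⟨U, T, hU, hT, hfac⟩ := hQ.exists_nonneg_factorization z hz c (fun a => supOn Q (c a))
      (fun a w hw => le_supOn (hbddQ a) hw)
    have hzero : ∀ a b : Finset (Fin m), (a ∩ b).card = 1 → ∑ k, U a k * T b k = 0 := by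
      intro a b h1
      rw [← hfac]
      have ht := htight a b h1
      rw [hxyz b, dotProduct_add] at ht
      have h1' : c a ⬝ᵥ z b ≤ supOn Q (c a) := le_supOn (hbddQ a) (hz b)
      have h2' : supOn Q (c a) ≤ d a - c a ⬝ᵥ y b := supOn_le hQne fun w' hw' => by
        have h := hvalid a (y b + w') (Set.add_mem_add (hy b) hw')
        rw [dotProduct_add] at h
        linarith
      linarith
    have hcount := card_filter_pos_le_of_factor U T hU hT hzero
    rw [Fintype.card_option, Fintype.card_fin] at hcount
    refine le_trans (card_le_card fun p hp => ?_) hcount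
    rw [mem_filter] at hp ⊢
    refine ⟨hp.1, ?_⟩
    rw [← hfac]
    have hab : Disjoint p.1 p.2 := (mem_disjPairs.1 hp.1).2.2
    have hs := hdisj p.1 p.2 hab
    rw [hxyz p.2, dotProduct_add] at hs
    linarith [hp.2]

end Split

/-! ## §3 Tree currency: `UPatAt` against a budgeted passenger = column compliance on an almost-unique-disjointness system of COR -/

section Currency

variable {h K m : ℕ}

/-- **column compliance**: passenger points `z b ∈ conv q`, each a COMMON MAXIMISER over `conv q` of every row of the star `{a : #(a ∩ b) = 1}`. -/
def Compliant (q : Fam h K) (c : Finset (Fin m) → (Fin h × Fin h → ℝ)) (z : Finset (Fin m) → (Fin h × Fin h → ℝ)) : Prop :=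
  (∀ b, z b ∈ convexHull ℝ (Set.range q)) ∧
    ∀ a b, (a ∩ b).card = 1 → ∀ w ∈ convexHull ℝ (Set.range q), c a ⬝ᵥ w ≤ c a ⬝ᵥ z b

open Classical in
/-- **`CorPat D c δ y`**: an ALMOST-unique-disjointness system of `COR(K_h)` with at most `D` defects — rows `c a · x ≤ δ a` valid on
`COR(K_h)`, points `y b ∈ COR(K_h)` (`a, b ⊆ Fin m`), tight whenever `#(a ∩ b) = 1`, and at most `D` DISJOINT cells that are tight too
(`D = 0`: a genuine unique-disjointness pattern of COR, impossible for `m` large by `corPat_three_pow_le`). -/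
def CorPat (D : ℕ) (c : Finset (Fin m) → (Fin h × Fin h → ℝ)) (δ : Finset (Fin m) → ℝ) (y : Finset (Fin m) → (Fin h × Fin h → ℝ)) :
    Prop :=
  (∀ a, ∀ x ∈ corPolytopeGraph (⊤ : SimpleGraph (Fin h)), c a ⬝ᵥ x ≤ δ a) ∧
    (∀ b, y b ∈ corPolytopeGraph (⊤ : SimpleGraph (Fin h))) ∧
    (∀ a b, (a ∩ b).card = 1 → c a ⬝ᵥ y b = δ a) ∧
    ((disjPairs (univ : Finset (Fin m))).filter fun p => c p.1 ⬝ᵥ y p.2 = δ p.1).card ≤ D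

open Classical in
/-- ★★ **`UPat ∘ budget ⊆ column-PCM ∘ almost-UDISJ(COR)`.**  Against a passenger with a size-`r` extended formulation, every unique-disjointness
pattern of order `m` on `COR(K_h) + conv q` is: an almost-unique-disjointness system of COR with at most `(r+1)·2^m` defects, whose rows are
column-compliant with the passenger, the defects being exactly the cells the passenger pays for. -/
theorem uPatAt_split {q : Fam h K} (hq : UPatAt q m) {r : ℕ} (hB : HasEFOfSize (convexHull ℝ (Set.range q)) r) :
    ∃ (c : Finset (Fin m) → (Fin h × Fin h → ℝ)) (δ δQ : Finset (Fin m) → ℝ) (y z : Finset (Fin m) → (Fin h × Fin h → ℝ)),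
      CorPat ((r + 1) * 2 ^ m) c δ y ∧ Compliant q c z ∧
      (∀ a, ∀ w ∈ convexHull ℝ (Set.range q), c a ⬝ᵥ w ≤ δQ a) ∧ (∀ a b, (a ∩ b).card = 1 → c a ⬝ᵥ z b = δQ a) ∧
      (∀ a b, Disjoint a b → c a ⬝ᵥ y b = δ a → c a ⬝ᵥ z b < δQ a) := by
  obtain ⟨c, d, x, hval, hx, htight, hdisj⟩ := hq
  obtain ⟨dP, dQ, y, z, hy, hz, -, -, hvP, hvQ, ht2, hcomp, -, hdef, hcard⟩ := exists_split hB c d x hval hx htight hdisj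
  exact ⟨c, dP, dQ, y, z, ⟨hvP, hy, fun a b h1 => (ht2 a b h1).1, hcard⟩, ⟨hz, hcomp⟩, hvQ, fun a b h1 => (ht2 a b h1).2, hdef⟩

open Classical in
/-- ★ **the converse recipe**: a defect-free unique-disjointness system of COR whose rows are column-compliant with the passenger IS a
`UPatAt` pattern on the sum (rows `(c a, δ a + max_{conv q} c a)`, points `y b + z b`). -/
theorem uPatAt_of_corPat {q : Fam h K} {c : Finset (Fin m) → (Fin h × Fin h → ℝ)} {δ : Finset (Fin m) → ℝ}
    {y z : Finset (Fin m) → (Fin h × Fin h → ℝ)} (hP : CorPat 0 c δ y) (hC : Compliant q c z) : UPatAt q m := by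
  obtain ⟨hvP, hy, ht, hcard⟩ := hP
  obtain ⟨hz, hcomp⟩ := hC
  -- the passenger maximum of each row is attained at a generator
  have hgen : ∀ a, ∃ j, ∀ w ∈ convexHull ℝ (Set.range q), c a ⬝ᵥ w ≤ c a ⬝ᵥ q j := by
    intro a
    obtain ⟨j, -, hj⟩ := exists_max_image (univ : Finset (Fin (K + 1))) (fun j => c a ⬝ᵥ q j) univ_nonempty
    refine ⟨j, Summit.ValiantsHypothesis.ValiantsHypothesis.Theorems.FifoMatching.XcDivision.dot_le_of_mem_convexHull _ (c a) _ ?_⟩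
    rintro _ ⟨j', rfl⟩
    exact hj j' (mem_univ j')
  choose j hj using hgen
  refine ⟨c, fun a => δ a + c a ⬝ᵥ q (j a), fun b => y b + z b, ?_, ?_, ?_, ?_⟩
  · intro a w hw
    obtain ⟨u, hu, v, hv, rfl⟩ := Set.mem_add.1 hw
    rw [dotProduct_add]
    exact add_le_add (hvP a u hu) (hj a v hv)
  · exact fun b => Set.add_mem_add (hy b) (hz b)
  · intro a b h1
    rw [dotProduct_add, ht a b h1]
    have h₁ := hj a (z b) (hz b)
    have h₂ := hcomp a b h1 (q (j a)) (subset_convexHull ℝ _ ⟨j a, rfl⟩)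
    linarith
  · intro a b hab
    rw [dotProduct_add]
    have h₁ := hj a (z b) (hz b)
    have hne : c a ⬝ᵥ y b ≠ δ a := by
      intro heq
      have hmem : (a, b) ∈ (disjPairs (univ : Finset (Fin m))).filter fun p => c p.1 ⬝ᵥ y p.2 = δ p.1 :=
        mem_filter.2 ⟨mem_disjPairs.2 ⟨subset_univ _, subset_univ _, hab⟩, heq⟩
      rw [Nat.le_zero, card_eq_zero] at hcard
      rw [hcard] at hmem
      exact notMem_empty _ hmem
    have hlt : c a ⬝ᵥ y b < δ a := lt_of_le_of_ne (hvP a (y b) (hy b)) hne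
    linarith

/-- every finite family's hull has SOME extended formulation (its V-representation, Literature `hasEFOfSize_convexHull_finset`). -/
theorem hasEFOfSize_hull_range (q : Fam h K) : ∃ r, HasEFOfSize (convexHull ℝ (Set.range q)) r := by
  classical
  refine ⟨(univ.image q).card, ?_⟩
  have hS := Literature.Barriers.PneNP.hasEFOfSize_convexHull_finset (univ.image q)
  rwa [coe_image, coe_univ, Set.image_univ] at hS

open Classical in
/-- the budget-free form of the split as an EQUIVALENCE: a pattern on the sum is exactly a pair (COR system tight on `#(a∩b)=1`, compliant
passenger points) whose two slacks never vanish together on a disjoint cell. -/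
theorem uPatAt_iff {q : Fam h K} : UPatAt q m ↔
    ∃ (c : Finset (Fin m) → (Fin h × Fin h → ℝ)) (δ δQ : Finset (Fin m) → ℝ) (y z : Finset (Fin m) → (Fin h × Fin h → ℝ)),
      (∀ a, ∀ w ∈ corPolytopeGraph (⊤ : SimpleGraph (Fin h)), c a ⬝ᵥ w ≤ δ a) ∧ (∀ b, y b ∈ corPolytopeGraph (⊤ : SimpleGraph (Fin h))) ∧
      (∀ a, ∀ w ∈ convexHull ℝ (Set.range q), c a ⬝ᵥ w ≤ δQ a) ∧ (∀ b, z b ∈ convexHull ℝ (Set.range q)) ∧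
      (∀ a b, (a ∩ b).card = 1 → c a ⬝ᵥ y b = δ a ∧ c a ⬝ᵥ z b = δQ a) ∧
      (∀ a b, Disjoint a b → c a ⬝ᵥ y b < δ a ∨ c a ⬝ᵥ z b < δQ a) := by
  classical
  constructor
  · rintro ⟨c, d, x, hval, hx, htight, hdisj⟩
    obtain ⟨r, hr⟩ := hasEFOfSize_hull_range q
    obtain ⟨dP, dQ, y, z, hy, hz, -, -, hvP, hvQ, ht2, -, hor, -, -⟩ := exists_split hr c d x hval hx htight hdisj
    exact ⟨c, dP, dQ, y, z, hvP, hy, hvQ, hz, ht2, hor⟩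
  · rintro ⟨c, δ, δQ, y, z, hvP, hy, hvQ, hz, ht, hor⟩
    refine ⟨c, fun a => δ a + δQ a, fun b => y b + z b, ?_, fun b => Set.add_mem_add (hy b) (hz b), ?_, ?_⟩
    · intro a w hw
      obtain ⟨u, hu, v, hv, rfl⟩ := Set.mem_add.1 hw
      rw [dotProduct_add]
      exact add_le_add (hvP a u hu) (hvQ a v hv)
    · intro a b h1
      rw [dotProduct_add, (ht a b h1).1, (ht a b h1).2]
    · intro a b hab
      rw [dotProduct_add]
      rcases hor a b hab with hlt | hlt
      · linarith [hvQ a (z b) (hz b)]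
      · linarith [hvP a (y b) (hy b)]

open Classical in
/-- the defect-tolerant bound in tree currency: an almost-unique-disjointness system of COR with `D` defects forces
`3^m ≤ (r'+1)·2^m + D` for every size-`r'` EF of `COR(K_h)` itself (with `D = 0` and `m = h`: the Kaibel–Weltge bound for COR). -/
theorem corPat_three_pow_le {D : ℕ} {c : Finset (Fin m) → (Fin h × Fin h → ℝ)} {δ : Finset (Fin m) → ℝ}
    {y : Finset (Fin m) → (Fin h × Fin h → ℝ)} (hP : CorPat D c δ y) {r' : ℕ}
    (hEF : HasEFOfSize (corPolytopeGraph (⊤ : SimpleGraph (Fin h))) r') : 3 ^ m ≤ (r' + 1) * 2 ^ m + D := by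
  obtain ⟨hvP, hy, ht, hcard⟩ := hP
  have := three_pow_le_add_card_defects hEF y hy c δ hvP ht
  omega

end Currency

end Summit.ValiantsHypothesis.ValiantsHypothesis.Theorems.FifoMatching.PatternSplit
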